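import Summits.QuantumFields.YangMills.Theorems.UnitScaleTiltProp7TransplantDipolePotential
import Summits.QuantumFields.YangMills.Theorems.UnitScaleTiltProp7InterpErrorPinReaction
import HarnessLib

/-!
# Route `UnitScaleTilt`, crux K1 «MinimiserStabilityRegPr» (stmt-QuantumFields-19200), route-R E′ path (α′), (E1-b) at the CURVED background, (A-cov) gen-0, FILE «CUTOFF POTENTIAL ROWS»:
# THE CUT-OFF DIPOLE POTENTIAL `ψ := χ·V` AND ITS ONE-LAPLACIAN SPLIT — `Δψ = g + c₁`, `Δg = (𝟙_{b+e_μ} − 𝟙_b) + c₂` with `g := χ·ΔV`, the commutators `c₁ = [Δ,χ]V` (`≤ C∕ℓ_c²`) and `c₂ = [Δ,χ]ΔV`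
# (`≤ C∕ℓ_c⁴`) bounded by the SYMMETRIC form `Σ_μ(∂⁺_μχ·(f(·+μ) − f(·−μ)) + Δ_μχ·f(·−μ))`, and the radial rows of `ψ`, `g` (`|ψ| ≤ C`, `|∂^±ψ| ≤ C∕(1∨r)`, `|g| ≤ C∕(1∨r)²`, `|∂^±g| ≤ C∕(1∨r)³`),
# all supported in the ball `tdist(·, b) < 9ℓ_c (+1)` — the scalars of the gen-0 transplant `V⁰ = ψ•R(Fr)Y` in the flat-Laplacian letters of ✓p674125∕✓p675919∕✓p677027 (identity (ID′), bus 23:20Z)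

Cell `ym3-torus`, width seat `ym3-torus-px22` (gen 3); gen-0 file 2 (file 1 = ✓p677890 `…TransplantDipolePotential`).  WHY ONE LAPLACIAN AT A TIME: `V = O(1)` does not decay, so `[Δ², χ]V` would need fourth
differences of `G̃₂` (not in the kit); routing the first commutator `c₁` UNDIFFERENTIATED through the type-1 channel of ✓p677235 (`3W·‖ω(c₁•RY)‖ ≍ ℓ`) and only `c₂ = [Δ,χ]ΔV ≍ ℓ_c⁻⁴` through the site channel
(`5AW·‖ω(c₂•RY)‖ ≍ ℓ`) needs nothing beyond (K-2)(K-3)(K-4)(K-7).  THEOREMS ONLY (0 `def`, 0 `sorry`); `--supports stmt-QuantumFields-19200`, count-neutral.  YM₃ on T³ is a ladder rung (R3), not the Clay problem;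
nothing here claims the stub, the crux, d = 4 or the gap.

WHAT IS PROVED (ns `…Theorems.Prop7TransplantCutoffPotential`; `Site P 0`, `P.d = 3`, pole `b`, `r = tdist(·, b)`, cutoff scale `ℓ_c ≥ 2`, `T = torusT P 0`).
* §1 ★ `abs_laplace_mul_sub_mul_laplace_le` (the symmetric commutator bound, any real `χ f`), `cutoff_diff_le_div_max` (a scale-`ℓ_c` cutoff step is `≤ 15∕(1∨r)` wherever it is nonzero).
* §2 ★★★ `exists_cutoffPotential` — `∃ C ≥ 0, ∀ P (d = 3) k ≤ m+K, ∀ b μ, ∀ ℓ_c ≥ 2, ∃ ψ g c₁ c₂ : Site P 0 → ℝ`: support (`ψ = g = 0` for `r ≥ 9ℓ_c`, `c₁ = c₂ = 0` for `r ≥ 9ℓ_c + 1`), the two identities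
  `Σ_ν(2ψ z − ψ(T_νz) − ψ(T_ν⁻¹z)) = g z + c₁ z`, `Σ_ν(2g z − g(T_νz) − g(T_ν⁻¹z)) = (𝟙[z = b+e_μ] − 𝟙[z = b]) + c₂ z`, and the rows `|ψ| ≤ C`, `|ψ(T_ν^{±}z) − ψ z| ≤ C∕(1∨r)`, `|g| ≤ C∕(1∨r)²`,
  `|g(T_ν^{±}z) − g z| ≤ C∕(1∨r)³`, `|c₁| ≤ C∕ℓ_c²`, `|c₂| ≤ C∕ℓ_c⁴`.
HONEST SCOPE.  Flat lattice bookkeeping over ✓p677890 and ✓p660942 `Prop7TorusScaleCutoff.exists_scale_cutoff`; the frame, the covariant identity and the numbers are the next file.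

References: T. Bałaban, CMP 96 (1984) 223–250 [Balaban1984PropagatorsII] ((1.9) p.226); CMP 95 (1984) 17–40 [Balaban1984PropagatorsI] ((1.21) p.21); CMP 99 (1985) 75–102 [Balaban1985RegularSpaces] ((1.36) p.82).
-/

set_option autoImplicit false

noncomputable section

open scoped BigOperators
open Finset

namespace Summit.QuantumFields.YangMills.Theorems.Prop7TransplantCutoffPotential

open Literature.MathematicalPhysics.QuantumFieldTheory.Balaban1983to89
open LatticeFieldCalculus
open B9TorusCalculus (torusT torusT_apply torusT_symm_apply)
open B3Taylor310LocalRemainder (tdist_comm tdist_self)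
open Prop7TorusAgmonWeight (exists_scale_cutoff)
open Prop7PinnedKernelGeometry (tdist_shift_le_add_one tdist_le_tdist_shift_add_one tdist_unshift_le_add_one tdist_le_tdist_unshift_add_one)
open Prop7TransplantDipolePotential (exists_dipolePotential laplace_one_eq_sum_torusT)
open Prop7InterpErrorPinReaction (five_sqrt_three_le)

variable {P : Params} {j : ℕ}

/-! ## §1 Letters: the symmetric commutator bound, the cutoff step in radial currency -/

/-- ★ **THE SYMMETRIC COMMUTATOR BOUND** `[Δ, χ]f` AT ONE SITE: with `|χ(z+e_ν) − χ z| ≤ a`, `|χ(z+e_ν) + χ(z−e_ν) − 2χ z| ≤ a₂`, `|f(z ± e_ν) − f z| ≤ F₁`, `|f(z − e_ν)| ≤ F₀` for every `ν`: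
`|Δ₁(χ·f)(z) − χ(z)·Δ₁f(z)| ≤ d·(2a·F₁ + a₂·F₀)` — from the identity `Δ₁(χf) − χΔ₁f = −Σ_ν[(χ(z+e_ν) − χ z)(f(z+e_ν) − f(z−e_ν)) + (χ(z+e_ν) + χ(z−e_ν) − 2χ z)·f(z−e_ν)]`.
[cite: Balaban1984PropagatorsII, (1.9) p.226] -/
theorem abs_laplace_mul_sub_mul_laplace_le (χ f : Site P j → ℝ) (z : Site P j) {a a₂ F₀ F₁ : ℝ}
    (hχ1 : ∀ ν, |χ (z.shift ν) - χ z| ≤ a) (hχ2 : ∀ ν, |χ (z.shift ν) + χ (z.unshift ν) - 2 * χ z| ≤ a₂)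
    (hf1 : ∀ ν, |f (z.shift ν) - f z| ≤ F₁ ∧ |f (z.unshift ν) - f z| ≤ F₁) (hf0 : ∀ ν, |f (z.unshift ν)| ≤ F₀) :
    |laplace 1 (fun w => χ w * f w) z - χ z * laplace 1 f z| ≤ P.d * (2 * a * F₁ + a₂ * F₀) := by
  have e : laplace 1 (fun w => χ w * f w) z - χ z * laplace 1 f z
      = ∑ ν : Fin P.d, -((χ (z.shift ν) - χ z) * (f (z.shift ν) - f (z.unshift ν)) + (χ (z.shift ν) + χ (z.unshift ν) - 2 * χ z) * f (z.unshift ν)) := by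
    simp only [laplace, one_pow, one_smul, Finset.mul_sum, ← Finset.sum_sub_distrib]
    refine Finset.sum_congr rfl fun ν _ => ?_
    ring
  rw [e]
  refine (abs_sum_le_sum_abs _ _).trans ?_
  have hν : ∀ ν : Fin P.d, |-((χ (z.shift ν) - χ z) * (f (z.shift ν) - f (z.unshift ν)) + (χ (z.shift ν) + χ (z.unshift ν) - 2 * χ z) * f (z.unshift ν))|
      ≤ 2 * a * F₁ + a₂ * F₀ := by
    intro ν
    rw [abs_neg]
    have h1 : |f (z.shift ν) - f (z.unshift ν)| ≤ 2 * F₁ := by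
      have e2 : f (z.shift ν) - f (z.unshift ν) = (f (z.shift ν) - f z) - (f (z.unshift ν) - f z) := by ring
      rw [e2]
      exact (abs_sub _ _).trans (by linarith [(hf1 ν).1, (hf1 ν).2])
    have ha0 : 0 ≤ a := (abs_nonneg _).trans (hχ1 ν)
    have hF0 : 0 ≤ F₀ := (abs_nonneg _).trans (hf0 ν)
    calc _ ≤ |(χ (z.shift ν) - χ z) * (f (z.shift ν) - f (z.unshift ν))| + |(χ (z.shift ν) + χ (z.unshift ν) - 2 * χ z) * f (z.unshift ν)| := abs_add_le _ _
      _ = |χ (z.shift ν) - χ z| * |f (z.shift ν) - f (z.unshift ν)| + |χ (z.shift ν) + χ (z.unshift ν) - 2 * χ z| * |f (z.unshift ν)| := by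
          rw [abs_mul, abs_mul]
      _ ≤ a * (2 * F₁) + a₂ * F₀ :=
          add_le_add (mul_le_mul (hχ1 ν) h1 (abs_nonneg _) ha0) (mul_le_mul (hχ2 ν) (hf0 ν) (abs_nonneg _) ((abs_nonneg _).trans (hχ2 ν)))
      _ = 2 * a * F₁ + a₂ * F₀ := by ring
  calc _ ≤ ∑ _ν : Fin P.d, (2 * a * F₁ + a₂ * F₀) := Finset.sum_le_sum fun ν _ => hν ν
    _ = P.d * (2 * a * F₁ + a₂ * F₀) := by rw [Finset.sum_const, Finset.card_univ, Fintype.card_fin, nsmul_eq_mul]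

/-- **A SCALE-`ℓ_c` CUTOFF STEP IN RADIAL CURRENCY**: if `χ` vanishes on `{tdist(·, b) ≥ 9ℓ_c}` and its steps are `≤ 3∕(2ℓ_c)` (`ℓ_c ≥ 1`), then `|χ(z ± e_ν) − χ z| ≤ 15∕(1 ∨ tdist(z,b))` for EVERY `z`
(the step vanishes unless `tdist(z,b) < 9ℓ_c + 1 ≤ 10ℓ_c`). [cite: Balaban1984PropagatorsII, (1.9) p.226] -/
theorem cutoff_diff_le_div_max (b : Site P j) (χ : Site P j → ℝ) {ℓc : ℝ} (hℓc : 1 ≤ ℓc)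
    (h0 : ∀ x, 9 * ℓc ≤ (Site.tdist x b : ℝ) → χ x = 0)
    (h1 : ∀ x ν, |χ (x.shift ν) - χ x| ≤ 3 / (2 * ℓc) ∧ |χ (x.unshift ν) - χ x| ≤ 3 / (2 * ℓc)) (z : Site P j) (ν : Fin P.d) :
    |χ (z.shift ν) - χ z| ≤ 15 / max 1 ((Site.tdist z b : ℕ) : ℝ) ∧ |χ (z.unshift ν) - χ z| ≤ 15 / max 1 ((Site.tdist z b : ℕ) : ℝ) := by
  have hm1 : (1 : ℝ) ≤ max 1 ((Site.tdist z b : ℕ) : ℝ) := le_max_left _ _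
  by_cases hz : 9 * ℓc + 1 ≤ (Site.tdist z b : ℝ)
  · -- far: all three values vanish
    have hz0 : χ z = 0 := h0 z (by linarith)
    have hs : χ (z.shift ν) = 0 := h0 _ (by
      have := tdist_le_tdist_shift_add_one z b ν
      have h' : ((Site.tdist z b : ℕ) : ℝ) ≤ (Site.tdist (z.shift ν) b : ℝ) + 1 := by exact_mod_cast this
      linarith)
    have hu : χ (z.unshift ν) = 0 := h0 _ (by
      have := tdist_le_tdist_unshift_add_one z b ν
      have h' : ((Site.tdist z b : ℕ) : ℝ) ≤ (Site.tdist (z.unshift ν) b : ℝ) + 1 := by exact_mod_cast this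
      linarith)
    rw [hz0, hs, hu, sub_zero, abs_zero]
    exact ⟨by positivity, by positivity⟩
  · -- near: `1 ∨ r ≤ 10ℓ_c`
    rw [not_le] at hz
    have hmax : max 1 ((Site.tdist z b : ℕ) : ℝ) ≤ 10 * ℓc := max_le (by linarith) (by linarith)
    have hkey : 3 / (2 * ℓc) ≤ 15 / max 1 ((Site.tdist z b : ℕ) : ℝ) := by
      rw [div_le_div_iff₀ (by linarith) (by linarith)]
      linarith
    exact ⟨(h1 z ν).1.trans hkey, (h1 z ν).2.trans hkey⟩

/-! ## §2 ★★★ The cut-off potential, its one-Laplacian split and its rows -/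

/-- ★★★ **THE CUT-OFF DIPOLE POTENTIAL `ψ = χ·V`, ITS SPLIT `Δψ = g + c₁`, `Δg = (𝟙_{b+e_μ} − 𝟙_b) + c₂`, AND ALL ROWS** (see the module docstring; `d = 3`, `ℓ_c ≥ 2`, ONE absolute `C`; `χ` = ✓ `exists_scale_cutoff` at the
pole `b` and scale `ℓ_c`, `V` = ✓ `exists_dipolePotential`; `g := χ·ΔV`, `c₁ := Δψ − g`, `c₂ := Δg − Δ²V`, the flat Laplacians displayed in the `Σ_ν(2f − f(T_ν·) − f(T_ν⁻¹·))` letters).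
[cite: Balaban1984PropagatorsII, (1.9) p.226; Balaban1984PropagatorsI, (1.21) p.21; Balaban1985RegularSpaces, (1.36) p.82] -/
theorem exists_cutoffPotential : ∃ C : ℝ, 0 ≤ C ∧ ∀ (P : Params) (_ : P.d = 3) (k : ℕ) (_ : k ≤ P.m + P.K) (b : Site P 0) (μ : Fin P.d) (ℓc : ℝ) (_ : 2 ≤ ℓc),
    ∃ ψ g c₁ c₂ : Site P 0 → ℝ,
      (∀ z, 9 * ℓc ≤ (Site.tdist z b : ℝ) → ψ z = 0 ∧ g z = 0) ∧
      (∀ z, 9 * ℓc + 1 ≤ (Site.tdist z b : ℝ) → c₁ z = 0 ∧ c₂ z = 0) ∧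
      (∀ z, ∑ ν : Fin P.d, (2 * ψ z - ψ (torusT P 0 ν z) - ψ ((torusT P 0 ν).symm z)) = g z + c₁ z) ∧
      (∀ z, ∑ ν : Fin P.d, (2 * g z - g (torusT P 0 ν z) - g ((torusT P 0 ν).symm z))
        = ((if z = b.shift μ then (1 : ℝ) else 0) - (if z = b then (1 : ℝ) else 0)) + c₂ z) ∧
      (∀ z, |ψ z| ≤ C) ∧
      (∀ z ν, |ψ (torusT P 0 ν z) - ψ z| ≤ C / max 1 ((Site.tdist z b : ℕ) : ℝ) ∧ |ψ ((torusT P 0 ν).symm z) - ψ z| ≤ C / max 1 ((Site.tdist z b : ℕ) : ℝ)) ∧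
      (∀ z, |g z| ≤ C / (max 1 ((Site.tdist z b : ℕ) : ℝ)) ^ 2) ∧
      (∀ z ν, |g (torusT P 0 ν z) - g z| ≤ C / (max 1 ((Site.tdist z b : ℕ) : ℝ)) ^ 3 ∧ |g ((torusT P 0 ν).symm z) - g z| ≤ C / (max 1 ((Site.tdist z b : ℕ) : ℝ)) ^ 3) ∧
      (∀ z, |c₁ z| ≤ C / ℓc ^ 2) ∧
      (∀ z, |c₂ z| ≤ C / ℓc ^ 4) := by
  obtain ⟨C, hC, HV⟩ := exists_dipolePotential
  refine ⟨288 * C, by positivity, ?_⟩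
  intro P hd k hk b μ ℓc hℓc
  classical
  have hℓ1 : (1 : ℝ) ≤ ℓc := by linarith
  have hℓ0 : (0 : ℝ) < ℓc := by linarith
  obtain ⟨V, hLL, hV0, hV1, hV1', hV2, hV3, hV3'⟩ := HV P hd k hk b μ
  obtain ⟨χ, hχ01, hχin, hχout, hχ1, hχ2, -, -⟩ := exists_scale_cutoff (P := P) (j := 0) b hℓ1
  -- the cutoff vanishes beyond `9ℓ_c` (`5√3 ≤ 9`)
  have hd3 : (P.d : ℝ) = 3 := by exact_mod_cast hd
  have hχ0 : ∀ x : Site P 0, 9 * ℓc ≤ (Site.tdist x b : ℝ) → χ x = 0 := fun x hx => hχout x (by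
    rw [hd3]; nlinarith [five_sqrt_three_le, hℓ0.le])
  have hχr := cutoff_diff_le_div_max b χ hℓ1 hχ0 hχ1
  -- radial letters
  have hm1 : ∀ z : Site P 0, (1 : ℝ) ≤ max 1 ((Site.tdist z b : ℕ) : ℝ) := fun z => le_max_left _ _
  have hm0 : ∀ z : Site P 0, (0 : ℝ) < max 1 ((Site.tdist z b : ℕ) : ℝ) := fun z => lt_of_lt_of_le one_pos (hm1 z)
  have habsχ : ∀ z : Site P 0, |χ z| ≤ 1 := fun z => abs_le.2 ⟨by linarith [(hχ01 z).1], (hχ01 z).2⟩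
  -- the four scalars
  refine ⟨fun z => χ z * V z, fun z => χ z * laplace 1 V z,
    fun z => laplace 1 (fun w => χ w * V w) z - χ z * laplace 1 V z,
    fun z => laplace 1 (fun w => χ w * laplace 1 V w) z - ((if z = b.shift μ then (1 : ℝ) else 0) - (if z = b then (1 : ℝ) else 0)),
    ?_, ?_, ?_, ?_, ?_, ?_, ?_, ?_, ?_, ?_⟩
  · -- support of `ψ`, `g`
    intro z hz
    simp only [hχ0 z hz, zero_mul, and_self]
  · -- support of `c₁`, `c₂`: every cutoff value in the stencil vanishes, and `z ∉ {b, b+e_μ}`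
    intro z hz
    have hz0 : χ z = 0 := hχ0 z (by linarith)
    have hs : ∀ ν, χ (z.shift ν) = 0 := fun ν => hχ0 _ (by
      have := tdist_le_tdist_shift_add_one z b ν
      have h' : ((Site.tdist z b : ℕ) : ℝ) ≤ (Site.tdist (z.shift ν) b : ℝ) + 1 := by exact_mod_cast this
      linarith)
    have hu : ∀ ν, χ (z.unshift ν) = 0 := fun ν => hχ0 _ (by
      have := tdist_le_tdist_unshift_add_one z b ν
      have h' : ((Site.tdist z b : ℕ) : ℝ) ≤ (Site.tdist (z.unshift ν) b : ℝ) + 1 := by exact_mod_cast this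
      linarith)
    have hzb : z ≠ b := by
      intro h; subst h; rw [tdist_self] at hz; simp only [Nat.cast_zero] at hz; linarith
    have hzb' : z ≠ b.shift μ := by
      intro h; subst h
      have := tdist_shift_le_add_one b b μ
      rw [tdist_self] at this
      have h' : ((Site.tdist (b.shift μ) b : ℕ) : ℝ) ≤ 1 := by exact_mod_cast this
      linarith
    simp only [laplace, one_pow, one_smul, hz0, hs, hu, zero_mul, sub_zero, add_zero, Finset.sum_const_zero, if_neg hzb, if_neg hzb', and_self]
  · -- `Δψ = g + c₁` (definition of `c₁`, dictionary)
    intro z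
    beta_reduce
    rw [← laplace_one_eq_sum_torusT (fun w => χ w * V w) z]
    ring
  · -- `Δg = (𝟙_{b+e_μ} − 𝟙_b) + c₂` (definition of `c₂`, dictionary)
    intro z
    beta_reduce
    rw [← laplace_one_eq_sum_torusT (fun w => χ w * laplace 1 V w) z]
    ring
  · -- `|ψ| ≤ C ≤ 288C`
    intro z
    rw [abs_mul]
    have := mul_le_mul (habsχ z) (hV0 z) (abs_nonneg _) zero_le_one
    linarith
  · -- `|∂^±ψ| ≤ 16C/(1∨r)`
    intro z ν
    simp only [torusT_apply, torusT_symm_apply]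
    have key : ∀ (y : Site P 0), |χ y - χ z| ≤ 15 / max 1 ((Site.tdist z b : ℕ) : ℝ) → |V y - V z| ≤ C / max 1 ((Site.tdist z b : ℕ) : ℝ) →
        |χ y * V y - χ z * V z| ≤ 288 * C / max 1 ((Site.tdist z b : ℕ) : ℝ) := by
      intro y hy hVy
      have e : χ y * V y - χ z * V z = χ y * (V y - V z) + (χ y - χ z) * V z := by ring
      rw [e]
      calc _ ≤ |χ y * (V y - V z)| + |(χ y - χ z) * V z| := abs_add_le _ _
        _ = |χ y| * |V y - V z| + |χ y - χ z| * |V z| := by rw [abs_mul, abs_mul]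
        _ ≤ 1 * (C / max 1 ((Site.tdist z b : ℕ) : ℝ)) + 15 / max 1 ((Site.tdist z b : ℕ) : ℝ) * C := by
            gcongr
            · exact habsχ y
            · exact hV0 z
        _ = 16 * C / max 1 ((Site.tdist z b : ℕ) : ℝ) := by ring
        _ ≤ 288 * C / max 1 ((Site.tdist z b : ℕ) : ℝ) := by
            rw [div_le_div_iff_of_pos_right (hm0 z)]; nlinarith
    exact ⟨key _ (hχr z ν).1 (hV1 z ν), key _ (hχr z ν).2 (hV1' z ν)⟩
  · -- `|g| ≤ C/(1∨r)²`
    intro z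
    rw [abs_mul]
    have := mul_le_mul (habsχ z) (hV2 z) (abs_nonneg _) zero_le_one
    have h2 : C / (max 1 ((Site.tdist z b : ℕ) : ℝ)) ^ 2 ≤ 288 * C / (max 1 ((Site.tdist z b : ℕ) : ℝ)) ^ 2 := by
      rw [div_le_div_iff_of_pos_right (pow_pos (hm0 z) 2)]; nlinarith
    linarith
  · -- `|∂^±g| ≤ 16C/(1∨r)³`
    intro z ν
    simp only [torusT_apply, torusT_symm_apply]
    have key : ∀ (y : Site P 0), |χ y - χ z| ≤ 15 / max 1 ((Site.tdist z b : ℕ) : ℝ) → |laplace 1 V y - laplace 1 V z| ≤ C / (max 1 ((Site.tdist z b : ℕ) : ℝ)) ^ 3 →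
        |χ y * laplace 1 V y - χ z * laplace 1 V z| ≤ 288 * C / (max 1 ((Site.tdist z b : ℕ) : ℝ)) ^ 3 := by
      intro y hy hVy
      have e : χ y * laplace 1 V y - χ z * laplace 1 V z = χ y * (laplace 1 V y - laplace 1 V z) + (χ y - χ z) * laplace 1 V z := by ring
      rw [e]
      calc _ ≤ |χ y * (laplace 1 V y - laplace 1 V z)| + |(χ y - χ z) * laplace 1 V z| := abs_add_le _ _
        _ = |χ y| * |laplace 1 V y - laplace 1 V z| + |χ y - χ z| * |laplace 1 V z| := by rw [abs_mul, abs_mul]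
        _ ≤ 1 * (C / (max 1 ((Site.tdist z b : ℕ) : ℝ)) ^ 3) + 15 / max 1 ((Site.tdist z b : ℕ) : ℝ) * (C / (max 1 ((Site.tdist z b : ℕ) : ℝ)) ^ 2) := by
            gcongr
            · exact habsχ y
            · exact hV2 z
        _ = 16 * C / (max 1 ((Site.tdist z b : ℕ) : ℝ)) ^ 3 := by
            field_simp
            ring
        _ ≤ 288 * C / (max 1 ((Site.tdist z b : ℕ) : ℝ)) ^ 3 := by
            rw [div_le_div_iff_of_pos_right (pow_pos (hm0 z) 3)]; nlinarith
    exact ⟨key _ (hχr z ν).1 (hV3 z ν), key _ (hχr z ν).2 (hV3' z ν)⟩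
  · -- `|c₁| ≤ 45C/ℓ_c²`: zero inside `r ≤ ℓ_c − 1`, symmetric commutator bound outside
    intro z
    beta_reduce
    by_cases hz : (Site.tdist z b : ℝ) ≤ ℓc - 1
    · -- inside: `χ = 1` on the stencil
      have hz1 : χ z = 1 := hχin z (by linarith)
      have hs : ∀ ν, χ (z.shift ν) = 1 := fun ν => hχin _ (by
        have := tdist_shift_le_add_one z b ν
        have h' : ((Site.tdist (z.shift ν) b : ℕ) : ℝ) ≤ (Site.tdist z b : ℝ) + 1 := by exact_mod_cast this
        linarith)
      have hu : ∀ ν, χ (z.unshift ν) = 1 := fun ν => hχin _ (by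
        have := tdist_unshift_le_add_one z b ν
        have h' : ((Site.tdist (z.unshift ν) b : ℕ) : ℝ) ≤ (Site.tdist z b : ℝ) + 1 := by exact_mod_cast this
        linarith)
      have e : laplace 1 (fun w => χ w * V w) z - χ z * laplace 1 V z = 0 := by
        simp only [laplace, one_pow, one_smul, hz1, hs, hu, one_mul, sub_self]
      rw [e, abs_zero]; positivity
    · rw [not_le] at hz
      have hr : ℓc / 2 ≤ max 1 ((Site.tdist z b : ℕ) : ℝ) := by
        have : (Site.tdist z b : ℝ) ≤ max 1 ((Site.tdist z b : ℕ) : ℝ) := le_max_right _ _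
        linarith
      have hinv : 1 / max 1 ((Site.tdist z b : ℕ) : ℝ) ≤ 2 / ℓc := by
        rw [div_le_div_iff₀ (hm0 z) hℓ0]; linarith
      have hF1 : C / max 1 ((Site.tdist z b : ℕ) : ℝ) ≤ 2 * C / ℓc := by
        have := mul_le_mul_of_nonneg_left hinv hC
        calc C / max 1 ((Site.tdist z b : ℕ) : ℝ) = C * (1 / max 1 ((Site.tdist z b : ℕ) : ℝ)) := by ring
          _ ≤ C * (2 / ℓc) := this
          _ = 2 * C / ℓc := by ring
      have h := abs_laplace_mul_sub_mul_laplace_le χ V z (a := 3 / (2 * ℓc)) (a₂ := 9 / ℓc ^ 2) (F₀ := C) (F₁ := 2 * C / ℓc)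
        (fun ν => (hχ1 z ν).1) (fun ν => hχ2 z ν) (fun ν => ⟨(hV1 z ν).trans hF1, (hV1' z ν).trans hF1⟩) (fun ν => hV0 _)
      rw [hd3] at h
      have h45 : (3 : ℝ) * (2 * (3 / (2 * ℓc)) * (2 * C / ℓc) + 9 / ℓc ^ 2 * C) = 45 * C / ℓc ^ 2 := by
        field_simp; ring
      rw [h45] at h
      refine h.trans ?_
      rw [div_le_div_iff_of_pos_right (pow_pos hℓ0 2)]; nlinarith
  · -- `|c₂| ≤ 288C/ℓ_c⁴`: the dipole term cancels against `χ·Δ²V` (`χ = 1` at `b`, `b + e_μ`), then as for `c₁` with `f = ΔV`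
    intro z
    beta_reduce
    -- `χ z·Δ²V z = 𝟙 − 𝟙`
    have hdip : χ z * laplace 1 (laplace 1 V) z = (if z = b.shift μ then (1 : ℝ) else 0) - (if z = b then (1 : ℝ) else 0) := by
      rw [hLL z]
      by_cases h1 : z = b.shift μ
      · have hχb : χ z = 1 := hχin z (by
          rw [h1]
          have := tdist_shift_le_add_one b b μ
          rw [tdist_self] at this
          have h' : ((Site.tdist (b.shift μ) b : ℕ) : ℝ) ≤ 1 := by exact_mod_cast this
          linarith)
        rw [hχb, one_mul]
      · by_cases h2 : z = b
        · have hχb : χ z = 1 := hχin z (by rw [h2, tdist_self]; simp only [Nat.cast_zero]; linarith)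
          rw [hχb, one_mul]
        · rw [if_neg h1, if_neg h2, sub_zero, mul_zero]
    have e0 : laplace 1 (fun w => χ w * laplace 1 V w) z - ((if z = b.shift μ then (1 : ℝ) else 0) - (if z = b then (1 : ℝ) else 0))
        = laplace 1 (fun w => χ w * laplace 1 V w) z - χ z * laplace 1 (laplace 1 V) z := by rw [hdip]
    rw [e0]
    by_cases hz : (Site.tdist z b : ℝ) ≤ ℓc - 1
    · have hz1 : χ z = 1 := hχin z (by linarith)
      have hs : ∀ ν, χ (z.shift ν) = 1 := fun ν => hχin _ (by
        have := tdist_shift_le_add_one z b ν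
        have h' : ((Site.tdist (z.shift ν) b : ℕ) : ℝ) ≤ (Site.tdist z b : ℝ) + 1 := by exact_mod_cast this
        linarith)
      have hu : ∀ ν, χ (z.unshift ν) = 1 := fun ν => hχin _ (by
        have := tdist_unshift_le_add_one z b ν
        have h' : ((Site.tdist (z.unshift ν) b : ℕ) : ℝ) ≤ (Site.tdist z b : ℝ) + 1 := by exact_mod_cast this
        linarith)
      have e : laplace 1 (fun w => χ w * laplace 1 V w) z - χ z * laplace 1 (laplace 1 V) z = 0 := by
        simp only [laplace, one_pow, one_smul, hz1, hs, hu, one_mul, sub_self]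
      rw [e, abs_zero]; positivity
    · rw [not_le] at hz
      have hr : ℓc / 2 ≤ max 1 ((Site.tdist z b : ℕ) : ℝ) := by
        have : (Site.tdist z b : ℝ) ≤ max 1 ((Site.tdist z b : ℕ) : ℝ) := le_max_right _ _
        linarith
      have hinv : 1 / max 1 ((Site.tdist z b : ℕ) : ℝ) ≤ 2 / ℓc := by
        rw [div_le_div_iff₀ (hm0 z) hℓ0]; linarith
      have hinv0 : 0 ≤ 1 / max 1 ((Site.tdist z b : ℕ) : ℝ) := by positivity
      have hinv2 : 1 / (max 1 ((Site.tdist z b : ℕ) : ℝ)) ^ 2 ≤ (2 / ℓc) ^ 2 := by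
        rw [← one_div_pow]; exact pow_le_pow_left₀ hinv0 hinv 2
      have hinv3 : 1 / (max 1 ((Site.tdist z b : ℕ) : ℝ)) ^ 3 ≤ (2 / ℓc) ^ 3 := by
        rw [← one_div_pow]; exact pow_le_pow_left₀ hinv0 hinv 3
      -- `F₁ = 8C/ℓ_c³`, `F₀ = 4C/ℓ_c² + 8C/ℓ_c³ ≤ 8C/ℓ_c²`
      have hF1 : C / (max 1 ((Site.tdist z b : ℕ) : ℝ)) ^ 3 ≤ 8 * C / ℓc ^ 3 := by
        have := mul_le_mul_of_nonneg_left hinv3 hC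
        calc C / (max 1 ((Site.tdist z b : ℕ) : ℝ)) ^ 3 = C * (1 / (max 1 ((Site.tdist z b : ℕ) : ℝ)) ^ 3) := by ring
          _ ≤ C * (2 / ℓc) ^ 3 := this
          _ = 8 * C / ℓc ^ 3 := by ring
      have hF2 : C / (max 1 ((Site.tdist z b : ℕ) : ℝ)) ^ 2 ≤ 4 * C / ℓc ^ 2 := by
        have := mul_le_mul_of_nonneg_left hinv2 hC
        calc C / (max 1 ((Site.tdist z b : ℕ) : ℝ)) ^ 2 = C * (1 / (max 1 ((Site.tdist z b : ℕ) : ℝ)) ^ 2) := by ring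
          _ ≤ C * (2 / ℓc) ^ 2 := this
          _ = 4 * C / ℓc ^ 2 := by ring
      have h83 : 8 * C / ℓc ^ 3 ≤ 4 * C / ℓc ^ 2 := by
        rw [div_le_div_iff₀ (pow_pos hℓ0 3) (pow_pos hℓ0 2)]
        have : ℓc ^ 3 = ℓc ^ 2 * ℓc := by ring
        nlinarith [pow_pos hℓ0 2, mul_nonneg hC (pow_pos hℓ0 2).le]
      have hF0 : ∀ ν, |laplace 1 V (z.unshift ν)| ≤ 8 * C / ℓc ^ 2 := by
        intro ν
        have e : laplace 1 V (z.unshift ν) = laplace 1 V z + (laplace 1 V (z.unshift ν) - laplace 1 V z) := by ring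
        rw [e]
        refine (abs_add_le _ _).trans ?_
        have h8 : 8 * C / ℓc ^ 2 = 4 * C / ℓc ^ 2 + 4 * C / ℓc ^ 2 := by ring
        linarith [hV2 z, (hV3' z ν), hF2, hF1, h83]
      have h := abs_laplace_mul_sub_mul_laplace_le χ (laplace 1 V) z (a := 3 / (2 * ℓc)) (a₂ := 9 / ℓc ^ 2) (F₀ := 8 * C / ℓc ^ 2) (F₁ := 8 * C / ℓc ^ 3)
        (fun ν => (hχ1 z ν).1) (fun ν => hχ2 z ν) (fun ν => ⟨(hV3 z ν).trans hF1, (hV3' z ν).trans hF1⟩) hF0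
      rw [hd3] at h
      refine h.trans (le_of_eq ?_)
      field_simp
      ring

end Summit.QuantumFields.YangMills.Theorems.Prop7TransplantCutoffPotential

end
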